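import Literature.Probability.RandomPlanarGeometry.SLEBubblesCloud
import HarnessLib

/-!
# Measurable events of the bubble space `Ω_b`: hitting a compact subset of `ℍ`

Elementary measure theory of the space `Ω_b` of bubbles at `0` ([LSW] §7.1) with its avoidance
σ-field (`Literature.Probability.RandomPlanarGeometry.BubbleConfig`, file `BrownianBubbles`:
generated by the events `{K ∩ A = ∅}`, `A ∈ 𝒬*`), after

* G. F. Lawler, O. Schramm, W. Werner, *Conformal restriction: the chordal case*, J. Amer. Math.
  Soc. **16** (2003) 917–955, arXiv:math/0209343 (**[LSW]**), §7.1 (p. 28: "the space `Ω_b` of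
  connected bounded sets `K ⊂ ℍ` such that `cl K = K ∪ {0}` and `ℍ ∖ K` is connected") with
  §3 p. 10 (the avoidance σ-field; "the same as the Borel σ-field induced by the Hausdorff
  metric").

Towards the measurability half `SLEBubbles.nullMeasurableSet_disjoint` of [LSW] Thm. 7.3
(`SLEBubblesVersion`): the event that the cloud of bubbles misses a hull is described through
the events "`K` hits `g_t(A) − W_t`", whose measurability in `(K, ω, t)` jointly rests on
approximating the hitting of a set by the hitting of dyadic squares. This file supplies the
`Ω_b`-side of that approximation:

* `Literature.Probability.RandomPlanarGeometry.BubbleConfig.exists_dyadicUnion_isStarHull_hpFill_of_isCompact`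
  — for `K ∈ Ω_b` and a compact `C ⊆ ℍ ∖ K`, some finite union `S ⊇ C` of closed dyadic
  squares has a fill `hpFill S` ([LSW] §2 "Fillings", `HalfPlaneFill`) which is a `*`-hull
  avoided by `K` (the argument of `BubbleConfig.exists_dyadicUnion_isStarHull_hpFill` for a
  point, file `SLEBubblesCloud`, run with finitely many paths: cover `C` by finitely many closed
  discs inside the open connected set `ℍ ∖ K`, join their centres to the far point
  `w₀ = R + 2 + i` inside `ℍ ∖ K`, drop the stick `[R + 2, w₀]` to the real axis, and take the
  dyadic squares of a fine generation meeting this compact connected set; `K`, together with a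
  half-disc at `0` and the strip `{0 < Im < η/2, Re < R + 1}`, escapes to infinity off the
  squares, so it lies in the unbounded component of the complement and misses the fill, which
  does not contain `0`);
* `Literature.Probability.RandomPlanarGeometry.BubbleConfig.avoid_eq_iUnion_dyadic_of_isCompact`,
  `…measurableSet_avoid_of_isCompact`, `…measurableSet_hit_of_isCompact` — **for a compact
  `C ⊆ ℍ` the events `{K ∩ C = ∅}`, `{K ∩ C ≠ ∅}` are measurable**: `{K ∩ C = ∅}` is the
  countable union of the generating events `{K ∩ hpFill S = ∅}` over the finite unions `S ⊇ C`
  of dyadic squares with a `*`-hull fill; in particular `{K : z ∈ K}` is measurable for every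
  `z` (`measurableSet_mem`).

Mathlib: `IsCompact.elim_nhds_subcover`, `JoinedIn.somePath`, `IsOpen.isConnected_iff_isPathConnected`,
`IsCompact.exists_cthickening_subset_open`, `isPreconnected_of_forall`, `Set.Finite.isCompact_biUnion`.
-/

noncomputable section

open Set Filter Topology MeasureTheory Metric Bornology
open UpperHalfPlane (upperHalfPlaneSet isOpen_upperHalfPlaneSet)
open scoped NNReal ENNReal

namespace Literature.Probability.RandomPlanarGeometry

namespace BubbleConfig

/-! ### A compact set off a bubble is swallowed by a dyadic `*`-hull avoided by the bubble -/

/-- **A compact subset of `ℍ` off a bubble lies in a `*`-hull avoided by the bubble, the fill of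
a finite union of dyadic squares.** For `K ∈ Ω_b` and a compact `C ⊆ ℍ ∖ K`: cover `C` by
finitely many closed discs inside the open connected set `ℍ ∖ K` ([LSW] §7.1: "`ℍ ∖ K` is
connected") and join their centres to the far point `w₀ = R + 2 + i` (`K ⊆ B̄(0, R)`) by paths
in `ℍ ∖ K`; with the stick `[R + 2, w₀]` this is a compact connected set `C' ⊇ C` attached to the
real axis, off `cl K = K ∪ {0}`, and the dyadic squares of a fine generation meeting `C'` form a
compact `S ⊇ C` inside `{Im ≥ η/2} ∪ {Re ≥ R + 1}` (`η = min Im` on `C' ∖ stick`). The connected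
set `K`, together with a half-disc at `0` and the unbounded strip `{0 < Im < η/2, Re < R + 1}`,
misses `S`, so it lies in the unbounded component of `ℍ ∖ S`: `K` avoids `hpFill S`, and
`0 ∉ hpFill S`, which is therefore a `*`-hull (`isStarHull_hpFill`). [folklore] -/
theorem exists_dyadicUnion_isStarHull_hpFill_of_isCompact (K : BubbleConfig) {C₀ : Set ℂ}
    (hC₀ : IsCompact C₀) (hC₀H : C₀ ⊆ upperHalfPlaneSet) (hC₀K : Disjoint C₀ (K : Set ℂ)) :
    ∃ (n : ℕ) (F : Finset (ℤ × ℤ)), C₀ ⊆ dyadicUnion n F ∧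
      IsStarHull (hpFill (dyadicUnion n F)) ∧ Disjoint (K : Set ℂ) (hpFill (dyadicUnion n F)) := by
  classical
  -- the open connected set `U = ℍ ∖ K` contains `C₀` and the far point `w₀`
  set U : Set ℂ := upperHalfPlaneSet \ (K : Set ℂ) with hU
  have hUo : IsOpen U := K.isOpen_diff
  have hUc : IsConnected U := K.isConnected_diff
  have hC₀U : C₀ ⊆ U := fun c hc ↦ ⟨hC₀H hc, Set.disjoint_left.1 hC₀K hc⟩
  obtain ⟨R, hRpos, hR⟩ := K.isBounded.subset_closedBall_lt 0 0
  set w₀ : ℂ := ((R + 2 : ℝ) : ℂ) + Complex.I with hw₀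
  have hw₀re : w₀.re = R + 2 := by simp [hw₀]
  have hw₀im : w₀.im = 1 := by simp [hw₀]
  have hfar : ∀ w : ℂ, w.re = R + 2 → w ∉ closure (K : Set ℂ) := fun w hw hcl ↦ by
    rw [K.closure_eq] at hcl
    rcases hcl with h | h
    · have h1 := hR h
      rw [mem_closedBall, dist_zero_right] at h1
      have h2 := (Complex.re_le_norm w).trans h1
      rw [hw] at h2
      linarith
    · rw [mem_singleton_iff] at h
      rw [h, Complex.zero_re] at hw
      linarith
  have hw₀U : w₀ ∈ U := by
    refine ⟨by rw [show w₀ ∈ upperHalfPlaneSet ↔ 0 < w₀.im from Iff.rfl, hw₀im]; exact one_pos,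
      fun h ↦ hfar w₀ hw₀re (subset_closure h)⟩
  -- finitely many closed discs inside `U` covering `C₀`, their centres joined to `w₀` inside `U`
  have hdisc : ∀ c ∈ C₀, ∃ r > 0, closedBall c r ⊆ U := fun c hc ↦ by
    obtain ⟨r, hr, hball⟩ := Metric.isOpen_iff.1 hUo c (hC₀U hc)
    exact ⟨r / 2, half_pos hr, closedBall_subset_ball (half_lt_self hr) |>.trans hball⟩
  choose! r hr hrU using hdisc
  obtain ⟨t, htC₀, hcover⟩ := hC₀.elim_nhds_subcover (fun c ↦ ball c (r c))
    (fun c hc ↦ ball_mem_nhds c (hr c hc))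
  have hJ : ∀ c ∈ C₀, JoinedIn U c w₀ := fun c hc ↦
    (hUo.isConnected_iff_isPathConnected.1 hUc).joinedIn c (hC₀U hc) _ hw₀U
  set P : ℂ → Set ℂ := fun c ↦ if hc : c ∈ C₀ then range (hJ c hc).somePath else ∅ with hP
  have hPc : ∀ c, IsCompact (P c) := fun c ↦ by
    simp only [hP]
    split_ifs with hc
    · exact isCompact_range (hJ c hc).somePath.continuous
    · exact isCompact_empty
  have hPU : ∀ c, P c ⊆ U := fun c ↦ by
    simp only [hP]
    split_ifs with hc
    · rintro _ ⟨s, rfl⟩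
      exact (hJ c hc).somePath_mem s
    · exact empty_subset _
  have hPconn : ∀ c ∈ C₀, IsConnected (P c) ∧ c ∈ P c ∧ w₀ ∈ P c := fun c hc ↦ by
    simp only [hP, dif_pos hc]
    exact ⟨isConnected_range (hJ c hc).somePath.continuous, ⟨0, (hJ c hc).somePath.source⟩,
      ⟨1, (hJ c hc).somePath.target⟩⟩
  set C₁ : Set ℂ := {w₀} ∪ ⋃ c ∈ t, (closedBall c (r c) ∪ P c) with hC₁
  have hC₁c : IsCompact C₁ :=
    isCompact_singleton.union (t.finite_toSet.isCompact_biUnion fun c _ ↦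
      (isCompact_closedBall c (r c)).union (hPc c))
  have hC₁U : C₁ ⊆ U := by
    rintro w (hw | hw)
    · rw [mem_singleton_iff] at hw
      rw [hw]
      exact hw₀U
    · rw [mem_iUnion₂] at hw
      obtain ⟨c, hct, hw | hw⟩ := hw
      · exact hrU c (htC₀ c hct) hw
      · exact hPU c hw
  have hw₀C₁ : w₀ ∈ C₁ := Or.inl rfl
  have hC₀C₁ : C₀ ⊆ C₁ := fun c' hc' ↦ by
    have := hcover hc'
    rw [mem_iUnion₂] at this
    obtain ⟨c, hct, hc'c⟩ := this
    exact Or.inr (mem_iUnion₂.2 ⟨c, hct, Or.inl (ball_subset_closedBall hc'c)⟩)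
  have hC₁conn : IsConnected C₁ := by
    refine ⟨⟨w₀, hw₀C₁⟩, isPreconnected_of_forall w₀ ?_⟩
    rintro y (hy | hy)
    · rw [mem_singleton_iff] at hy
      exact ⟨{w₀}, subset_union_left, rfl, hy, isPreconnected_singleton⟩
    · rw [mem_iUnion₂] at hy
      obtain ⟨c, hct, hyc⟩ := hy
      obtain ⟨hPcconn, hcP, hw₀P⟩ := hPconn c (htC₀ c hct)
      refine ⟨closedBall c (r c) ∪ P c, fun w hw ↦ Or.inr (mem_iUnion₂.2 ⟨c, hct, hw⟩),
        Or.inr hw₀P, hyc, ?_⟩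
      exact IsPreconnected.union c (mem_closedBall_self (hr c (htC₀ c hct)).le) hcP
        (convex_closedBall c (r c)).isPreconnected hPcconn.isPreconnected
  -- the stick from `w₀` down to `R + 2`
  set T : Set ℂ := (fun s : ℝ ↦ ((R + 2 : ℝ) : ℂ) + s * Complex.I) '' Icc 0 1 with hT
  have hTre : ∀ w ∈ T, w.re = R + 2 := by
    rintro _ ⟨s, -, rfl⟩
    simp
  have hw₀T : w₀ ∈ T := ⟨1, ⟨zero_le_one, le_rfl⟩, by simp [hw₀]⟩
  have hfootT : (((R + 2 : ℝ) : ℂ)) ∈ T := ⟨0, ⟨le_rfl, zero_le_one⟩, by simp⟩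
  set C : Set ℂ := C₁ ∪ T with hC
  have hTc : IsCompact T := isCompact_Icc.image (by fun_prop)
  have hCc : IsCompact C := hC₁c.union hTc
  -- `C` lies in the open set `O = (cl K)ᶜ`
  set O : Set ℂ := (closure (K : Set ℂ))ᶜ with hO
  have hOo : IsOpen O := isClosed_closure.isOpen_compl
  have hCO : C ⊆ O := by
    rintro w (hw | hw)
    · exact notMem_closure (hC₁U hw).1 (hC₁U hw).2
    · exact hfar w (hTre w hw)
  -- `C` is connected and attached to the real axis at `R + 2`
  have hTconn : IsConnected T := (isConnected_Icc zero_le_one).image _ (by fun_prop)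
  have hCconn : IsConnected C := IsConnected.union ⟨w₀, hw₀C₁, hw₀T⟩ hC₁conn hTconn
  -- `η = min Im` on `C₁` is positive
  obtain ⟨c₀, hc₀, hc₀min⟩ := hC₁c.exists_isMinOn ⟨w₀, hw₀C₁⟩ Complex.continuous_im.continuousOn
  set η : ℝ := c₀.im with hη
  have hηpos : 0 < η := (hC₁U hc₀).1
  have hηle : ∀ c ∈ C₁, η ≤ c.im := fun c hc ↦ hc₀min hc
  -- a fine generation `n`
  obtain ⟨δ, hδ, hδO⟩ := hCc.exists_cthickening_subset_open hOo hCO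
  set ε : ℝ := min δ (min (η / 2) 1) with hε
  have hεpos : 0 < ε := lt_min hδ (lt_min (half_pos hηpos) one_pos)
  have hεδ : ε ≤ δ := min_le_left _ _
  have hεη : ε ≤ η / 2 := (min_le_right _ _).trans (min_le_left _ _)
  have hε1 : ε ≤ 1 := (min_le_right _ _).trans (min_le_right _ _)
  obtain ⟨n, hn⟩ : ∃ n : ℕ, (2 : ℝ) / 2 ^ n ≤ ε := by
    obtain ⟨n, hn⟩ := exists_nat_gt (2 / ε)
    refine ⟨n, ?_⟩
    have h2n : (n : ℝ) < 2 ^ n := by exact_mod_cast Nat.lt_two_pow_self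
    have h2 : (0 : ℝ) < 2 ^ n := by positivity
    rw [div_le_iff₀ h2]
    rw [div_lt_iff₀ hεpos] at hn
    nlinarith
  -- the squares meeting `C`
  set F : Finset (ℤ × ℤ) := (finite_setOf_dyadicSquare_inter_nonempty hCc.isBounded n).toFinset with hF
  have hmemF : ∀ p : ℤ × ℤ, p ∈ F ↔ (dyadicSquare n p.1 p.2 ∩ C).Nonempty := fun p ↦ by
    rw [hF, Set.Finite.mem_toFinset]
    rfl
  set S : Set ℂ := dyadicUnion n F with hS
  -- `C ⊆ S ⊆ O`, and every point of `S` is within `ε` of `C`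
  have hCS : C ⊆ S := fun w hw ↦ by
    rw [hS, mem_dyadicUnion_iff]
    exact ⟨⟨_, _⟩, (hmemF _).2 ⟨w, mem_dyadicSquare_floor w n, hw⟩, mem_dyadicSquare_floor w n⟩
  have hnear : ∀ w ∈ S, ∃ c ∈ C, dist w c ≤ ε := fun w hw ↦ by
    rw [hS, mem_dyadicUnion_iff] at hw
    obtain ⟨p, hp, hwp⟩ := hw
    obtain ⟨c, hcp, hcC⟩ := (hmemF p).1 hp
    exact ⟨c, hcC, (dist_le_of_mem_dyadicSquare hwp hcp).trans hn⟩
  have hSO : S ⊆ O := fun w hw ↦ by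
    obtain ⟨c, hcC, hwc⟩ := hnear w hw
    exact hδO (mem_cthickening_of_dist_le w c δ C hcC (hwc.trans hεδ))
  -- points of `S` are high (near `C₁`) or far to the right (near the stick)
  have hSloc : ∀ w ∈ S, η / 2 ≤ w.im ∨ R + 1 ≤ w.re := fun w hw ↦ by
    obtain ⟨c, hcC, hwc⟩ := hnear w hw
    rw [dist_eq_norm] at hwc
    rcases hcC with hc | hc
    · left
      have h1 := (Complex.abs_im_le_norm (w - c)).trans hwc
      rw [Complex.sub_im, abs_le] at h1
      linarith [hηle c hc, h1.1]
    · right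
      have h1 := (Complex.abs_re_le_norm (w - c)).trans hwc
      rw [Complex.sub_re, abs_le, hTre c hc] at h1
      linarith [h1.1]
  have hKS : Disjoint (K : Set ℂ) S :=
    Set.disjoint_left.2 fun w hwK hwS ↦ hSO hwS (subset_closure hwK)
  have h0S : (0 : ℂ) ∉ S := fun h ↦ hSO h K.zero_mem_closure
  have hSclosed : IsClosed S := isClosed_dyadicUnion
  have hSb : IsBounded S := isBounded_dyadicUnion
  -- `S ∪ {Im ≤ 0}` is connected: every square meets the connected set `C ∪ {Im ≤ 0} ∋ R + 2`
  have hconn : IsConnected (S ∪ {w : ℂ | w.im ≤ 0}) := by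
    have hfoot0 : (((R + 2 : ℝ) : ℂ)) ∈ {w : ℂ | w.im ≤ 0} := by simp
    have hD : IsPreconnected (C ∪ {w : ℂ | w.im ≤ 0}) :=
      (hCconn.union ⟨((R + 2 : ℝ) : ℂ), Or.inr hfootT, hfoot0⟩
        ((convex_halfSpace_im_le 0).isConnected ⟨0, by simp⟩)).isPreconnected
    have hDsub : C ∪ {w : ℂ | w.im ≤ 0} ⊆ S ∪ {w : ℂ | w.im ≤ 0} := union_subset_union_left _ hCS
    refine ⟨⟨_, Or.inl (hCS (Or.inr hfootT))⟩, isPreconnected_of_forall (((R + 2 : ℝ) : ℂ)) ?_⟩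
    rintro y (hy | hy)
    · rw [hS, mem_dyadicUnion_iff] at hy
      obtain ⟨p, hp, hyp⟩ := hy
      obtain ⟨c, hcp, hcC⟩ := (hmemF p).1 hp
      refine ⟨dyadicSquare n p.1 p.2 ∪ (C ∪ {w : ℂ | w.im ≤ 0}), ?_, Or.inr (Or.inl (Or.inr hfootT)),
        Or.inl hyp, ?_⟩
      · refine union_subset (fun w hw ↦ Or.inl ?_) hDsub
        rw [hS, mem_dyadicUnion_iff]
        exact ⟨p, hp, hw⟩
      · exact IsPreconnected.union c hcp (Or.inl hcC) convex_dyadicSquare.isPreconnected hD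
    · exact ⟨C ∪ {w : ℂ | w.im ≤ 0}, hDsub, Or.inl (Or.inr hfootT), Or.inr hy, hD⟩
  -- `K`, a half-disc at `0` and the strip `L` lie in the unbounded component `V` of `ℍ ∖ S`
  set V : Set ℂ := Loewner.unboundedComponent (upperHalfPlaneSet \ S) with hV
  obtain ⟨ρ, hρ, hρS⟩ : ∃ ρ > 0, ball (0 : ℂ) ρ ⊆ Sᶜ :=
    Metric.isOpen_iff.1 hSclosed.isOpen_compl 0 h0S
  set W : Set ℂ := ball (0 : ℂ) ρ ∩ upperHalfPlaneSet with hW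
  set L : Set ℂ := {w : ℂ | 0 < w.im ∧ w.im < η / 2 ∧ w.re < R + 1} with hL
  obtain ⟨k, hkK, hkρ⟩ : ((K : Set ℂ) ∩ ball 0 ρ).Nonempty := by
    have := K.zero_mem_closure
    rw [_root_.mem_closure_iff] at this
    obtain ⟨k, hk1, hk2⟩ := this (ball 0 ρ) isOpen_ball (mem_ball_self hρ)
    exact ⟨k, hk2, hk1⟩
  -- a common point of `W` and `L`
  set t₀ : ℝ := min ρ (η / 2) / 2 with ht₀
  have ht₀pos : 0 < t₀ := by positivity
  have ht₀ρ : t₀ < ρ := by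
    have : min ρ (η / 2) ≤ ρ := min_le_left _ _
    rw [ht₀]; linarith
  have ht₀η : t₀ < η / 2 := by
    have : min ρ (η / 2) ≤ η / 2 := min_le_right _ _
    rw [ht₀]; linarith
  set q₀ : ℂ := (t₀ : ℂ) * Complex.I with hq₀
  have hq₀im : q₀.im = t₀ := by simp [hq₀]
  have hq₀re : q₀.re = 0 := by simp [hq₀]
  have hq₀W : q₀ ∈ W := by
    refine ⟨?_, by rw [show q₀ ∈ upperHalfPlaneSet ↔ 0 < q₀.im from Iff.rfl, hq₀im]; exact ht₀pos⟩
    rw [mem_ball, dist_zero_right]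
    have : ‖q₀‖ = t₀ := by
      rw [hq₀, norm_mul, Complex.norm_I, mul_one, Complex.norm_real, Real.norm_eq_abs, abs_of_pos ht₀pos]
    rw [this]
    exact ht₀ρ
  have hq₀L : q₀ ∈ L := by
    refine ⟨by rw [hq₀im]; exact ht₀pos, by rw [hq₀im]; exact ht₀η, by rw [hq₀re]; linarith⟩
  have hLconv : Convex ℝ L := by
    have h1 : Convex ℝ {w : ℂ | 0 < w.im} := convex_halfSpace_im_gt 0
    have h2 : Convex ℝ {w : ℂ | w.im < η / 2} := convex_halfSpace_im_lt _
    have h3 : Convex ℝ {w : ℂ | w.re < R + 1} := convex_halfSpace_re_lt _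
    have : L = {w : ℂ | 0 < w.im} ∩ ({w : ℂ | w.im < η / 2} ∩ {w : ℂ | w.re < R + 1}) := by
      ext w; simp [hL]
    rw [this]
    exact h1.inter (h2.inter h3)
  have hLS : Disjoint L S := Set.disjoint_left.2 fun w hwL hwS ↦ by
    rcases hSloc w hwS with h | h
    · exact absurd hwL.2.1 (not_lt.2 h)
    · exact absurd hwL.2.2 (not_lt.2 h)
  have hLunb : ¬ IsBounded L := by
    intro hb
    obtain ⟨R', hR'pos, hR'⟩ := hb.subset_closedBall_lt 0 0
    set w : ℂ := ((-(R' + 1) : ℝ) : ℂ) + (t₀ : ℂ) * Complex.I with hw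
    have hwL : w ∈ L := by
      refine ⟨by simp [hw, ht₀pos], by simpa [hw] using ht₀η, ?_⟩
      simp [hw]
      linarith
    have h1 := hR' hwL
    rw [mem_closedBall, dist_zero_right] at h1
    have h2 := (Complex.abs_re_le_norm w).trans h1
    simp [hw] at h2
    rw [abs_of_neg (by linarith)] at h2
    linarith
  have hTV : (W ∪ L) ∪ (K : Set ℂ) ⊆ V := by
    refine subset_unboundedComponent_of_isPreconnected ?_ ?_ ?_
    · refine IsPreconnected.union k (Or.inl ⟨hkρ, K.subset_upperHalfPlaneSet hkK⟩) hkK ?_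
        K.isConnected.isPreconnected
      exact IsPreconnected.union q₀ hq₀W hq₀L
        ((convex_ball (0 : ℂ) ρ).inter (convex_halfSpace_im_gt 0)).isPreconnected hLconv.isPreconnected
    · rintro w ((⟨hwρ, hwH⟩ | hwL) | hwK)
      · exact ⟨hwH, fun hwS ↦ hρS hwρ hwS⟩
      · exact ⟨hwL.1, fun hwS ↦ Set.disjoint_left.1 hLS hwL hwS⟩
      · exact ⟨K.subset_upperHalfPlaneSet hwK, Set.disjoint_left.1 hKS hwK⟩
    · exact fun hb ↦ hLunb (hb.subset (subset_union_right.trans subset_union_left))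
  -- hence `0 ∉ hpFill S = cl (ℍ ∖ V)`
  have h0 : (0 : ℂ) ∉ hpFill S := by
    intro h0
    change (0 : ℂ) ∈ closure (upperHalfPlaneSet \ V) at h0
    rw [_root_.mem_closure_iff] at h0
    obtain ⟨u, huρ, huH, huV⟩ := h0 (ball 0 ρ) isOpen_ball (mem_ball_self hρ)
    exact huV (hTV (Or.inl (Or.inl ⟨huρ, huH⟩)))
  refine ⟨n, F, hC₀C₁.trans (subset_union_left.trans hCS),
    isStarHull_hpFill isSimplyConnected_of_isConnected_compl_holds hSclosed hSb hconn h0, ?_⟩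
  -- and `K ⊆ V` misses `hpFill S`
  refine Set.disjoint_left.2 fun w hwK hwF ↦ ?_
  have : w ∈ hpFill S ∩ upperHalfPlaneSet := ⟨hwF, K.subset_upperHalfPlaneSet hwK⟩
  rw [hpFill_inter hSclosed hSb] at this
  exact this.2 (hTV (Or.inr hwK))

/-! ### Hitting a compact subset of `ℍ` is a measurable event -/

/-- **The avoidance event of a compact subset of `ℍ` is a countable union of generating
events**: for a compact `C ⊆ ℍ`, `{K ∈ Ω_b : K ∩ C = ∅} = ⋃ {K : K ∩ hpFill S = ∅}` over the
finite unions `S ⊇ C` of closed dyadic squares whose fill is a `*`-hull (`⊇`: `C ⊆ S ∩ ℍ ⊆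
hpFill S`; `⊆`: `exists_dyadicUnion_isStarHull_hpFill_of_isCompact`).
[cite: LawlerSchrammWerner2003Restriction, §3 p. 10 (the σ-field) with §7.1 (p. 28, Ω_b)] -/
theorem avoid_eq_iUnion_dyadic_of_isCompact {C : Set ℂ} (hC : IsCompact C) (hCH : C ⊆ upperHalfPlaneSet) :
    avoid C = ⋃ (n : ℕ) (F : Finset (ℤ × ℤ))
      (_ : C ⊆ dyadicUnion n F ∧ IsStarHull (hpFill (dyadicUnion n F))),
        avoid (hpFill (dyadicUnion n F)) := by
  ext K
  simp only [mem_iUnion, mem_avoid]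
  constructor
  · intro hK
    obtain ⟨n, F, hsub, hstar, hd⟩ :=
      K.exists_dyadicUnion_isStarHull_hpFill_of_isCompact hC hCH hK.symm
    exact ⟨n, F, ⟨hsub, hstar⟩, hd⟩
  · rintro ⟨n, F, ⟨hsub, -⟩, hK⟩
    refine Set.disjoint_left.2 fun z hzK hzC ↦ Set.disjoint_left.1 hK hzK ?_
    exact inter_subset_hpFill _ ⟨hsub hzC, hCH hzC⟩

/-- **Avoiding a compact subset of `ℍ` is measurable** for the avoidance σ-field of `Ω_b`.
[cite: LawlerSchrammWerner2003Restriction, §3 p. 10 (the σ-field) with §7.1 (p. 28, Ω_b)] -/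
theorem measurableSet_avoid_of_isCompact {C : Set ℂ} (hC : IsCompact C) (hCH : C ⊆ upperHalfPlaneSet) :
    MeasurableSet (avoid C) := by
  rw [avoid_eq_iUnion_dyadic_of_isCompact hC hCH]
  exact MeasurableSet.iUnion fun _ ↦ MeasurableSet.iUnion fun _ ↦ MeasurableSet.iUnion fun h ↦
    measurableSet_avoid h.2

/-- **Hitting a compact subset of `ℍ` is measurable** for the avoidance σ-field of `Ω_b` (the
part of [LSW]'s remark "the σ-field is the same as the Borel σ-field induced by the Hausdorff
metric" that the hitting events of the bubble cloud need).
[cite: LawlerSchrammWerner2003Restriction, §3 p. 10 (the σ-field) with §7.1 (p. 28, Ω_b)] -/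
theorem measurableSet_hit_of_isCompact {C : Set ℂ} (hC : IsCompact C) (hCH : C ⊆ upperHalfPlaneSet) :
    MeasurableSet (hit C) := by
  rw [hit_eq_compl]
  exact (measurableSet_avoid_of_isCompact hC hCH).compl

/-- **Points are measurable**: `{K ∈ Ω_b : z ∈ K}` is measurable for every `z ∈ ℂ` (it is the
hitting event of the compact set `{z}` when `z ∈ ℍ`, and empty otherwise). [folklore] -/
theorem measurableSet_mem (z : ℂ) : MeasurableSet {K : BubbleConfig | z ∈ (K : Set ℂ)} := by
  by_cases hz : z ∈ upperHalfPlaneSet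
  · have : {K : BubbleConfig | z ∈ (K : Set ℂ)} = hit {z} := by
      ext K
      simp [mem_hit, Set.disjoint_singleton_right]
    rw [this]
    exact measurableSet_hit_of_isCompact isCompact_singleton (singleton_subset_iff.2 hz)
  · have : {K : BubbleConfig | z ∈ (K : Set ℂ)} = ∅ :=
      eq_empty_of_forall_notMem fun K hK ↦ hz (K.subset_upperHalfPlaneSet hK)
    rw [this]
    exact MeasurableSet.empty

/-- **Hitting a closed dyadic square inside `ℍ` is measurable** (the squares of the rows
`b ≥ 1` lie in `ℍ`), the form used to approximate the hitting of a set by countably many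
events. [folklore] -/
theorem measurableSet_hit_dyadicSquare {n : ℕ} {a b : ℤ} (hb : 1 ≤ b) :
    MeasurableSet (hit (dyadicSquare n a b)) := by
  refine measurableSet_hit_of_isCompact
    (Metric.isCompact_of_isClosed_isBounded isClosed_dyadicSquare isBounded_dyadicSquare) fun z hz ↦ ?_
  show 0 < z.im
  have h1 : (b : ℝ) / 2 ^ n ≤ z.im := hz.2.2.1
  have h2 : (0 : ℝ) < (b : ℝ) / 2 ^ n := by
    have : (1 : ℝ) ≤ b := by exact_mod_cast hb
    positivity
  exact h2.trans_le h1

end BubbleConfig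

end Literature.Probability.RandomPlanarGeometry

end
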